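import Literature.NumberTheory.Rogawski1990.ArchChartOrbGRescaling     -- ★ §2(6) p852217 (F0P3a-p04 (g27)): `stableSumG_orbFamGExt_eq_haarScalarFactor_mul`, `stableSumG_orbFamGExt_const_mul`, `ArchSmooth.const_mul`; brings ★ `isHaarMeasure_prodConventionG`, ★ `isMulRightInvariant_prodConventionG`, ★ `orbFamGExt`, ★ `stableSumG`, ★ `bzClassG`, `esymm3`, `RegG`
import HarnessLib

/-!
# EP ASSEMBLY, (L2)-MEASURES: the ball-by-ball transfer sentence is INDEPENDENT OF THE TWO HAAR MEASURES — any Haar pair `(ν′, νβ)` on `U(diag α)_∞ × U(diag β)_∞` reduces to the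
# product-convention pair `(e⁻¹_* ⊗_w ν′_w, e⁻¹_* ⊗_w νβ_w)` (Folland 1995 §2.2; Rogawski 1990 §1.7, §14.2)

Topic `NumberTheory/Rogawski1990`; namespace `Literature.NumberTheory.Rogawski1990`.  THEOREMS ONLY (no `def`, no instance, no notation, no axiom, no named fact, no `sorry`).
Cell `pub/hodgecm-mathlib`, crux H413 (`stmt-HodgeConjecture-24833`), line LH2 (closer stub `stub_N8`, organ (Sh)′), N8-INNER ROAD B «EP road» (dealer LH2-plan (g1)), brick (12′)∕E3
«EP ASSEMBLY = H-S4′», layer (L2) of E3a (pen LH7-p04 (g8), CENSUS-E3a v1.1 §4), glue item **«(L2)-measures»** (pen's offer 2026-09-02 17:34:18Z; hand LH3-p04 (g8)).  Count-neutral.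

THE POINT.  The E3 head (★ (L3) skeleton `stableSurjG_quasiSplit_of_ballTransfer`) and ★ E3-SUM ED. 2 `stableSurjG_of_ballTransfer_fixed` quantify over ARBITRARY Haar measures
`μ′` on `U(diag α)_∞` and `μ` on `U(diag β)_∞`, while every per-place tool (L2) feeds into ★ (L1) `ballIdentity_of_readings` — ★ (F2) tensor reading, ★ E2b∕(s1) definite closed form,
★ (IT)-3 block transport, the E1 generators — is stated under the PRODUCT convention `ν₀ = e⁻¹_* ⊗_w ν_w` (`e = archPiEquivCM 3 L (diagonal ·)`), with the `β`-side local measures on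
the `α`-indefinite block chosen as push-forwards of the `α`-side ones.  The transfer sentence of one ball,
`T(ν′, νβ; g) : ∃ f ∈ C_c^∞(U(diag β)_∞), ∀ S, ∀ c ∈ RegG S, SS_{νβ}(f) S c = κ · SS_{ν′}(g) S c`,
is INVARIANT under changing BOTH Haar measures: by Haar uniqueness the stable extended sums scale by the positive constants `haarScalarFactor` (★ p852217
`stableSumG_orbFamGExt_eq_haarScalarFactor_mul`, uniform in the label, the coordinate and the test function) and the test function absorbs the quotient of the two constants
(★ `stableSumG_orbFamGExt_const_mul`, ★ `ArchSmooth.const_mul`).  Hence the `hBall` bodies of E3-SUM (ED. 1 and ED. 2 shapes) at `(μ′, μ)` follow from the same bodies at the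
product-convention pair — (L2) proves them there and docks here with zero adapters.
* §1 `exists_archSmooth_stableSumG_eq_const_mul_of_isHaarMeasure` — the transfer sentence `T` transported from the reference pair `(ν₀′, ν₀)` to the free pair `(μ′, μ)` (all four Haar + right invariant);
  **`ballTransfer_of_isHaarMeasure`** — THE (L2)-MEASURES HEAD (pen LH7-p04 (g8), 17:37:09Z, token for token): the same for a family of sentences indexed by «ball data» `x : X`
  with admissibility `P x` and `α`-side test function `A x`.
* §2 the literal `hBall` binder shapes of ★ E3-SUM transported (zero-adapter corollaries): `ballTransferFixedBody_of_isHaarMeasure` (ED. 2 `_fixed` body, `a′` outside),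
  `ballTransferBody_of_isHaarMeasure` (ED. 1 body, `∀ a′` inside), `exists_radius_ballTransferFixedBody_of_isHaarMeasure` ∕ `exists_radius_ballTransferBody_of_isHaarMeasure` (the
  `∃ ε, (∀ w b, 0 < ε w b) ∧ …` packagings of the (L2) head ∕ the (L3) head's `hBall`).
* §3 the product-convention instances `exists_archSmooth_stableSumG_eq_const_mul_of_prodConvention`, **`ballTransfer_of_prodConvention`** (the head, generic `X`),
  `ballTransferFixedBody_of_prodConvention`, `ballTransferBody_of_prodConvention`, `exists_radius_ballTransferFixedBody_of_prodConvention`, `exists_radius_ballTransferBody_of_prodConvention`: reference pair `((Measure.pi ν′w).map eα.symm, (Measure.pi νβw).map eβ.symm)` for ANY Haar families `ν′w`, `νβw` on the place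
  components (★ `isHaarMeasure_prodConventionG`, ★ `isMulRightInvariant_prodConventionG`) — (L2) takes `νβw w := (ν′w w).map ι_w` on the `α`-indefinite block.
HONEST LABEL: (Sh)′ ∕ row `stub_N8` stay PRINT-labelled until E3 and its binders are ★ and the closer is re-keyed; HC_CM is proved only modulo the 7 printed citations (2 remaining:
hLiu418 = stmt-HodgeConjecture-24832, h413 = stmt-HodgeConjecture-24833) until rung 0 closes; measure bookkeeping, pays nothing by itself.

## References
* [Folland1995] G. B. Folland, *A Course in Abstract Harmonic Analysis* (1995), §2.2 Thm. 2.20 (uniqueness of Haar measure), §2.6 (2.52).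
* [Rogawski1990] J. D. Rogawski, *Automorphic Representations of Unitary Groups in Three Variables*, Ann. of Math. Stud. 123 (1990), §1.7 p. 6 (measures), §4.1 (4.1.1) p. 39,
  §14.2 (14.2.1) p. 232 (the transfer assembled from local data).
* [Shelstad1979] D. Shelstad, *Characters and inner forms of a quasi-split group over ℝ*, Compositio Math. 39 (1979), §4 p. 24.
* [BorelJacquet1979] A. Borel, H. Jacquet, *Automorphic forms and automorphic representations*, PSPM 33.1 (1979), §4.1.
-/

set_option autoImplicit false

noncomputable section

open MeasureTheory MeasureTheory.Measure NumberField NumberField.InfinitePlace Complex Set Function Metric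
open Literature.NumberTheory.Automorphic Literature.NumberTheory.Automorphic.UnitaryGroup Literature.NumberTheory.Automorphic.ArchCartan
open scoped Classical MatrixGroups Matrix NNReal ContDiff

namespace Literature.NumberTheory.Rogawski1990

/-! ## §1 The transfer sentence is independent of the two Haar measures -/

section Head

variable (L : Type) [Field L] [NumberField L] [IsCMField L] (α β : Fin 3 → L)
  [MeasurableSpace ↥(arch (↥(maximalRealSubfield L)) L (IsCMField.complexConj L) 3 (Matrix.diagonal α))] [BorelSpace ↥(arch (↥(maximalRealSubfield L)) L (IsCMField.complexConj L) 3 (Matrix.diagonal α))]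
  [MeasurableSpace ↥(arch (↥(maximalRealSubfield L)) L (IsCMField.complexConj L) 3 (Matrix.diagonal β))] [BorelSpace ↥(arch (↥(maximalRealSubfield L)) L (IsCMField.complexConj L) 3 (Matrix.diagonal β))]

/-- **THE TRANSFER SENTENCE OF ONE BALL IS INDEPENDENT OF THE TWO HAAR MEASURES.**  If some `f ∈ C_c^∞(U(diag β)_∞)` has `SS_{ν₀}(f) S c = κ · SS_{ν₀′}(g) S c` at every `G`-regular point
of every label, then some `f′ ∈ C_c^∞(U(diag β)_∞)` has `SS_{μ}(f′) S c = κ · SS_{μ′}(g) S c` there, for any other Haar measures `μ′`, `μ` — namely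
`f′ := (haarScalarFactor μ′ ν₀′ · (haarScalarFactor μ ν₀)⁻¹) · f` (★ `stableSumG_orbFamGExt_eq_haarScalarFactor_mul` on both sides, ★ `stableSumG_orbFamGExt_const_mul`,
★ `ArchSmooth.const_mul`). [cite: Folland1995, §2.2 Thm. 2.20; §2.6 (2.52)] [cite: Rogawski1990, §1.7 p. 6; §4.1 (4.1.1) p. 39] -/
theorem exists_archSmooth_stableSumG_eq_const_mul_of_isHaarMeasure (κ : ℂ) (g : ↥(arch (↥(maximalRealSubfield L)) L (IsCMField.complexConj L) 3 (Matrix.diagonal α)) → ℂ)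
    (ν₀' : Measure ↥(arch (↥(maximalRealSubfield L)) L (IsCMField.complexConj L) 3 (Matrix.diagonal α)))   -- reference Haar on `U(diag α)_∞` (the product convention in §3)
    (ν₀ : Measure ↥(arch (↥(maximalRealSubfield L)) L (IsCMField.complexConj L) 3 (Matrix.diagonal β)))    -- reference Haar on `U(diag β)_∞`
    (μ' : Measure ↥(arch (↥(maximalRealSubfield L)) L (IsCMField.complexConj L) 3 (Matrix.diagonal α)))    -- the head's free Haar on `U(diag α)_∞`
    (μ : Measure ↥(arch (↥(maximalRealSubfield L)) L (IsCMField.complexConj L) 3 (Matrix.diagonal β)))     -- the head's free Haar on `U(diag β)_∞`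
    [ν₀'.IsHaarMeasure] [ν₀'.IsMulRightInvariant] [ν₀.IsHaarMeasure] [ν₀.IsMulRightInvariant]
    [μ'.IsHaarMeasure] [μ'.IsMulRightInvariant] [μ.IsHaarMeasure] [μ.IsMulRightInvariant]
    (h : ∃ f : ↥(arch (↥(maximalRealSubfield L)) L (IsCMField.complexConj L) 3 (Matrix.diagonal β)) → ℂ, ArchSmooth L 3 (Matrix.diagonal β) f ∧
      ∀ (S : Finset {w : InfinitePlace L // IsComplex w}) (c : {w : InfinitePlace L // IsComplex w} → Fin 3 → ℝ), c ∈ RegG S →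
        stableSumG (orbFamGExt L β ν₀ f) S c = κ * stableSumG (orbFamGExt L α ν₀' g) S c) :
    ∃ f : ↥(arch (↥(maximalRealSubfield L)) L (IsCMField.complexConj L) 3 (Matrix.diagonal β)) → ℂ, ArchSmooth L 3 (Matrix.diagonal β) f ∧
      ∀ (S : Finset {w : InfinitePlace L // IsComplex w}) (c : {w : InfinitePlace L // IsComplex w} → Fin 3 → ℝ), c ∈ RegG S →
        stableSumG (orbFamGExt L β μ f) S c = κ * stableSumG (orbFamGExt L α μ' g) S c := by
  obtain ⟨f, hf, hS⟩ := h
  have hβ0 : ((haarScalarFactor μ ν₀ : ℝ) : ℂ) ≠ 0 := by exact_mod_cast (haarScalarFactor_pos_of_isHaarMeasure μ ν₀).ne'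
  refine ⟨fun k => (((haarScalarFactor μ' ν₀' : ℝ) : ℂ) * ((haarScalarFactor μ ν₀ : ℝ) : ℂ)⁻¹) * f k, hf.const_mul L β _, fun S c hc => ?_⟩
  rw [stableSumG_orbFamGExt_const_mul L β μ f _ S hc, stableSumG_orbFamGExt_eq_haarScalarFactor_mul L β μ f ν₀ S hc, hS S c hc,
    stableSumG_orbFamGExt_eq_haarScalarFactor_mul L α μ' g ν₀' S hc]
  field_simp

/-- **(L2)-MEASURES HEAD (pen LH7-p04 (g8) 2026-09-02 17:37:09Z, token for token): THE BALL-BY-BALL TRANSFER IS INDEPENDENT OF THE TWO HAAR MEASURES**, generic over an index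
type `X` of «ball data» with admissibility predicate `P` and `α`-side test functions `A x` — so this file never sees E3a's internals.  If every admissible `x` admits
`f ∈ C_c^∞(U(diag β)_∞)` with `SS_{ν₀}(f) S c = κ · SS_{ν₀′}(A x) S c` on every `RegG S` (reference Haar pair `(ν₀′, ν₀)`), then the same holds for the head's free Haar pair
`(μ′, μ)`.  (L2) instantiates `X := (↥D → ℂ³) × (↥D → ℂ³ → ℝ)`, `P := «centres in K ∧ smooth ∧ tsupport ⊆ balls»`, `A (ctr, F) := fun k => ↑(∏ v, F v (bzClassG L α k v)) * a′ k`,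
`(ν₀′, ν₀) :=` the product-convention pair (§3). [cite: Folland1995, §2.2 Thm. 2.20; §2.6 (2.52)] [cite: Rogawski1990, §1.7 p. 6; §14.2 (14.2.1) p. 232] [cite: Shelstad1979, §4 p. 24] -/
theorem ballTransfer_of_isHaarMeasure {X : Type*} (P : X → Prop) (A : X → ↥(arch (↥(maximalRealSubfield L)) L (IsCMField.complexConj L) 3 (Matrix.diagonal α)) → ℂ) (κ : ℂ)
    (ν₀' : Measure ↥(arch (↥(maximalRealSubfield L)) L (IsCMField.complexConj L) 3 (Matrix.diagonal α)))
    (ν₀ : Measure ↥(arch (↥(maximalRealSubfield L)) L (IsCMField.complexConj L) 3 (Matrix.diagonal β)))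
    (μ' : Measure ↥(arch (↥(maximalRealSubfield L)) L (IsCMField.complexConj L) 3 (Matrix.diagonal α)))
    (μ : Measure ↥(arch (↥(maximalRealSubfield L)) L (IsCMField.complexConj L) 3 (Matrix.diagonal β)))
    [ν₀'.IsHaarMeasure] [ν₀'.IsMulRightInvariant] [ν₀.IsHaarMeasure] [ν₀.IsMulRightInvariant]
    [μ'.IsHaarMeasure] [μ'.IsMulRightInvariant] [μ.IsHaarMeasure] [μ.IsMulRightInvariant]
    (h : ∀ x, P x → ∃ f : ↥(arch (↥(maximalRealSubfield L)) L (IsCMField.complexConj L) 3 (Matrix.diagonal β)) → ℂ, ArchSmooth L 3 (Matrix.diagonal β) f ∧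
      ∀ (S : Finset {w : InfinitePlace L // IsComplex w}) (c : {w : InfinitePlace L // IsComplex w} → Fin 3 → ℝ), c ∈ RegG S →
        stableSumG (orbFamGExt L β ν₀ f) S c = κ * stableSumG (orbFamGExt L α ν₀' (A x)) S c) :
    ∀ x, P x → ∃ f : ↥(arch (↥(maximalRealSubfield L)) L (IsCMField.complexConj L) 3 (Matrix.diagonal β)) → ℂ, ArchSmooth L 3 (Matrix.diagonal β) f ∧
      ∀ (S : Finset {w : InfinitePlace L // IsComplex w}) (c : {w : InfinitePlace L // IsComplex w} → Fin 3 → ℝ), c ∈ RegG S →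
        stableSumG (orbFamGExt L β μ f) S c = κ * stableSumG (orbFamGExt L α μ' (A x)) S c :=
  fun x hx => exists_archSmooth_stableSumG_eq_const_mul_of_isHaarMeasure L α β κ (A x) ν₀' ν₀ μ' μ (h x hx)

end Head

/-! ## §2 The literal `hBall` binder shapes of ★ E3-SUM transported -/

section Shapes

variable (L : Type) [Field L] [NumberField L] [IsCMField L] (α β : Fin 3 → L)
  [MeasurableSpace ↥(arch (↥(maximalRealSubfield L)) L (IsCMField.complexConj L) 3 (Matrix.diagonal α))] [BorelSpace ↥(arch (↥(maximalRealSubfield L)) L (IsCMField.complexConj L) 3 (Matrix.diagonal α))]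
  [MeasurableSpace ↥(arch (↥(maximalRealSubfield L)) L (IsCMField.complexConj L) 3 (Matrix.diagonal β))] [BorelSpace ↥(arch (↥(maximalRealSubfield L)) L (IsCMField.complexConj L) 3 (Matrix.diagonal β))]
  (ν₀' : Measure ↥(arch (↥(maximalRealSubfield L)) L (IsCMField.complexConj L) 3 (Matrix.diagonal α)))   -- reference Haar on `U(diag α)_∞`
  (ν₀ : Measure ↥(arch (↥(maximalRealSubfield L)) L (IsCMField.complexConj L) 3 (Matrix.diagonal β)))    -- reference Haar on `U(diag β)_∞`
  (μ' : Measure ↥(arch (↥(maximalRealSubfield L)) L (IsCMField.complexConj L) 3 (Matrix.diagonal α)))    -- free Haar on `U(diag α)_∞`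
  (μ : Measure ↥(arch (↥(maximalRealSubfield L)) L (IsCMField.complexConj L) 3 (Matrix.diagonal β)))     -- free Haar on `U(diag β)_∞`
  [ν₀'.IsHaarMeasure] [ν₀'.IsMulRightInvariant] [ν₀.IsHaarMeasure] [ν₀.IsMulRightInvariant]
  [μ'.IsHaarMeasure] [μ'.IsMulRightInvariant] [μ.IsHaarMeasure] [μ.IsMulRightInvariant]


/-- **E3-SUM ED. 2's `hBall` BODY (test function `a′` outside, radii `ε` fixed) IS INDEPENDENT OF THE TWO HAAR MEASURES.** [cite: Rogawski1990, §14.2 (14.2.1) p. 232; §1.7 p. 6]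
[cite: Folland1995, §2.2 Thm. 2.20] -/
theorem ballTransferFixedBody_of_isHaarMeasure (D : Finset {w : InfinitePlace L // IsComplex w})
    (a' : ↥(arch (↥(maximalRealSubfield L)) L (IsCMField.complexConj L) 3 (Matrix.diagonal α)) → ℂ)
    (ε : {w : InfinitePlace L // IsComplex w} → ℂ × ℂ × ℂ → ℝ) (κ : ℂ)
    (hBall : ∀ (ctr : ↥D → ℂ × ℂ × ℂ) (F : ↥D → ℂ × ℂ × ℂ → ℝ),
      (∀ v, ctr v ∈ Set.range fun t : Fin 3 → ℝ => esymm3 fun i => Complex.exp ((t i : ℂ) * I)) → (∀ v, ContDiff ℝ ∞ (F v)) →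
      (∀ v, tsupport (F v) ⊆ ball (ctr v) (ε v (ctr v))) →
        ∃ f : ↥(arch (↥(maximalRealSubfield L)) L (IsCMField.complexConj L) 3 (Matrix.diagonal β)) → ℂ, ArchSmooth L 3 (Matrix.diagonal β) f ∧
          ∀ (S : Finset {w : InfinitePlace L // IsComplex w}) (c : {w : InfinitePlace L // IsComplex w} → Fin 3 → ℝ), c ∈ RegG S →
            stableSumG (orbFamGExt L β ν₀ f) S c =
              κ * stableSumG (orbFamGExt L α ν₀' (fun k => ((∏ v, F v (bzClassG L α k v) : ℝ) : ℂ) * a' k)) S c) :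
    ∀ (ctr : ↥D → ℂ × ℂ × ℂ) (F : ↥D → ℂ × ℂ × ℂ → ℝ),
      (∀ v, ctr v ∈ Set.range fun t : Fin 3 → ℝ => esymm3 fun i => Complex.exp ((t i : ℂ) * I)) → (∀ v, ContDiff ℝ ∞ (F v)) →
      (∀ v, tsupport (F v) ⊆ ball (ctr v) (ε v (ctr v))) →
        ∃ f : ↥(arch (↥(maximalRealSubfield L)) L (IsCMField.complexConj L) 3 (Matrix.diagonal β)) → ℂ, ArchSmooth L 3 (Matrix.diagonal β) f ∧
          ∀ (S : Finset {w : InfinitePlace L // IsComplex w}) (c : {w : InfinitePlace L // IsComplex w} → Fin 3 → ℝ), c ∈ RegG S →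
            stableSumG (orbFamGExt L β μ f) S c =
              κ * stableSumG (orbFamGExt L α μ' (fun k => ((∏ v, F v (bzClassG L α k v) : ℝ) : ℂ) * a' k)) S c :=
  fun ctr F h1 h2 h3 => exists_archSmooth_stableSumG_eq_const_mul_of_isHaarMeasure L α β κ _ ν₀' ν₀ μ' μ (hBall ctr F h1 h2 h3)

/-- **E3-SUM ED. 1's `hBall` BODY (radii `ε` fixed, `∀ a′ ∈ C_c^∞` inside) IS INDEPENDENT OF THE TWO HAAR MEASURES.** [cite: Rogawski1990, §14.2 (14.2.1) p. 232; §1.7 p. 6]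
[cite: Folland1995, §2.2 Thm. 2.20] -/
theorem ballTransferBody_of_isHaarMeasure (D : Finset {w : InfinitePlace L // IsComplex w})
    (ε : {w : InfinitePlace L // IsComplex w} → ℂ × ℂ × ℂ → ℝ) (κ : ℂ)
    (hBall : ∀ (ctr : ↥D → ℂ × ℂ × ℂ) (F : ↥D → ℂ × ℂ × ℂ → ℝ),
      (∀ v, ctr v ∈ Set.range fun t : Fin 3 → ℝ => esymm3 fun i => Complex.exp ((t i : ℂ) * I)) → (∀ v, ContDiff ℝ ∞ (F v)) →
      (∀ v, tsupport (F v) ⊆ ball (ctr v) (ε v (ctr v))) →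
      ∀ a' : ↥(arch (↥(maximalRealSubfield L)) L (IsCMField.complexConj L) 3 (Matrix.diagonal α)) → ℂ, ArchSmooth L 3 (Matrix.diagonal α) a' →
        ∃ f : ↥(arch (↥(maximalRealSubfield L)) L (IsCMField.complexConj L) 3 (Matrix.diagonal β)) → ℂ, ArchSmooth L 3 (Matrix.diagonal β) f ∧
          ∀ (S : Finset {w : InfinitePlace L // IsComplex w}) (c : {w : InfinitePlace L // IsComplex w} → Fin 3 → ℝ), c ∈ RegG S →
            stableSumG (orbFamGExt L β ν₀ f) S c =
              κ * stableSumG (orbFamGExt L α ν₀' (fun k => ((∏ v, F v (bzClassG L α k v) : ℝ) : ℂ) * a' k)) S c) :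
    ∀ (ctr : ↥D → ℂ × ℂ × ℂ) (F : ↥D → ℂ × ℂ × ℂ → ℝ),
      (∀ v, ctr v ∈ Set.range fun t : Fin 3 → ℝ => esymm3 fun i => Complex.exp ((t i : ℂ) * I)) → (∀ v, ContDiff ℝ ∞ (F v)) →
      (∀ v, tsupport (F v) ⊆ ball (ctr v) (ε v (ctr v))) →
      ∀ a' : ↥(arch (↥(maximalRealSubfield L)) L (IsCMField.complexConj L) 3 (Matrix.diagonal α)) → ℂ, ArchSmooth L 3 (Matrix.diagonal α) a' →
        ∃ f : ↥(arch (↥(maximalRealSubfield L)) L (IsCMField.complexConj L) 3 (Matrix.diagonal β)) → ℂ, ArchSmooth L 3 (Matrix.diagonal β) f ∧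
          ∀ (S : Finset {w : InfinitePlace L // IsComplex w}) (c : {w : InfinitePlace L // IsComplex w} → Fin 3 → ℝ), c ∈ RegG S →
            stableSumG (orbFamGExt L β μ f) S c =
              κ * stableSumG (orbFamGExt L α μ' (fun k => ((∏ v, F v (bzClassG L α k v) : ℝ) : ℂ) * a' k)) S c :=
  fun ctr F h1 h2 h3 a' ha' => exists_archSmooth_stableSumG_eq_const_mul_of_isHaarMeasure L α β κ _ ν₀' ν₀ μ' μ (hBall ctr F h1 h2 h3 a' ha')

/-- **The `∃ ε, (∀ w b, 0 < ε w b) ∧ …` packaging of ED. 2's body (the (L2) head `ballTransfer_fixed`'s shape) is independent of the two Haar measures.**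
[cite: Rogawski1990, §14.2 (14.2.1) p. 232; §1.7 p. 6] [cite: Folland1995, §2.2 Thm. 2.20] -/
theorem exists_radius_ballTransferFixedBody_of_isHaarMeasure (D : Finset {w : InfinitePlace L // IsComplex w})
    (a' : ↥(arch (↥(maximalRealSubfield L)) L (IsCMField.complexConj L) 3 (Matrix.diagonal α)) → ℂ) (κ : ℂ)
    (hBall : ∃ ε : {w : InfinitePlace L // IsComplex w} → ℂ × ℂ × ℂ → ℝ, (∀ w b, 0 < ε w b) ∧
      ∀ (ctr : ↥D → ℂ × ℂ × ℂ) (F : ↥D → ℂ × ℂ × ℂ → ℝ),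
      (∀ v, ctr v ∈ Set.range fun t : Fin 3 → ℝ => esymm3 fun i => Complex.exp ((t i : ℂ) * I)) → (∀ v, ContDiff ℝ ∞ (F v)) →
      (∀ v, tsupport (F v) ⊆ ball (ctr v) (ε v (ctr v))) →
        ∃ f : ↥(arch (↥(maximalRealSubfield L)) L (IsCMField.complexConj L) 3 (Matrix.diagonal β)) → ℂ, ArchSmooth L 3 (Matrix.diagonal β) f ∧
          ∀ (S : Finset {w : InfinitePlace L // IsComplex w}) (c : {w : InfinitePlace L // IsComplex w} → Fin 3 → ℝ), c ∈ RegG S →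
            stableSumG (orbFamGExt L β ν₀ f) S c =
              κ * stableSumG (orbFamGExt L α ν₀' (fun k => ((∏ v, F v (bzClassG L α k v) : ℝ) : ℂ) * a' k)) S c) :
    ∃ ε : {w : InfinitePlace L // IsComplex w} → ℂ × ℂ × ℂ → ℝ, (∀ w b, 0 < ε w b) ∧
      ∀ (ctr : ↥D → ℂ × ℂ × ℂ) (F : ↥D → ℂ × ℂ × ℂ → ℝ),
      (∀ v, ctr v ∈ Set.range fun t : Fin 3 → ℝ => esymm3 fun i => Complex.exp ((t i : ℂ) * I)) → (∀ v, ContDiff ℝ ∞ (F v)) →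
      (∀ v, tsupport (F v) ⊆ ball (ctr v) (ε v (ctr v))) →
        ∃ f : ↥(arch (↥(maximalRealSubfield L)) L (IsCMField.complexConj L) 3 (Matrix.diagonal β)) → ℂ, ArchSmooth L 3 (Matrix.diagonal β) f ∧
          ∀ (S : Finset {w : InfinitePlace L // IsComplex w}) (c : {w : InfinitePlace L // IsComplex w} → Fin 3 → ℝ), c ∈ RegG S →
            stableSumG (orbFamGExt L β μ f) S c =
              κ * stableSumG (orbFamGExt L α μ' (fun k => ((∏ v, F v (bzClassG L α k v) : ℝ) : ℂ) * a' k)) S c := by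
  obtain ⟨ε, hε, hB⟩ := hBall
  exact ⟨ε, hε, ballTransferFixedBody_of_isHaarMeasure L α β ν₀' ν₀ μ' μ D a' ε κ hB⟩

/-- **The `∃ ε, (∀ w b, 0 < ε w b) ∧ …` packaging of ED. 1's body (the (L3) head `stableSurjG_quasiSplit_of_ballTransfer`'s `hBall` shape) is independent of the two Haar measures.**
[cite: Rogawski1990, §14.2 (14.2.1) p. 232; §1.7 p. 6] [cite: Folland1995, §2.2 Thm. 2.20] -/
theorem exists_radius_ballTransferBody_of_isHaarMeasure (D : Finset {w : InfinitePlace L // IsComplex w}) (κ : ℂ)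
    (hBall : ∃ ε : {w : InfinitePlace L // IsComplex w} → ℂ × ℂ × ℂ → ℝ, (∀ w b, 0 < ε w b) ∧
      ∀ (ctr : ↥D → ℂ × ℂ × ℂ) (F : ↥D → ℂ × ℂ × ℂ → ℝ),
      (∀ v, ctr v ∈ Set.range fun t : Fin 3 → ℝ => esymm3 fun i => Complex.exp ((t i : ℂ) * I)) → (∀ v, ContDiff ℝ ∞ (F v)) →
      (∀ v, tsupport (F v) ⊆ ball (ctr v) (ε v (ctr v))) →
      ∀ a' : ↥(arch (↥(maximalRealSubfield L)) L (IsCMField.complexConj L) 3 (Matrix.diagonal α)) → ℂ, ArchSmooth L 3 (Matrix.diagonal α) a' →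
        ∃ f : ↥(arch (↥(maximalRealSubfield L)) L (IsCMField.complexConj L) 3 (Matrix.diagonal β)) → ℂ, ArchSmooth L 3 (Matrix.diagonal β) f ∧
          ∀ (S : Finset {w : InfinitePlace L // IsComplex w}) (c : {w : InfinitePlace L // IsComplex w} → Fin 3 → ℝ), c ∈ RegG S →
            stableSumG (orbFamGExt L β ν₀ f) S c =
              κ * stableSumG (orbFamGExt L α ν₀' (fun k => ((∏ v, F v (bzClassG L α k v) : ℝ) : ℂ) * a' k)) S c) :
    ∃ ε : {w : InfinitePlace L // IsComplex w} → ℂ × ℂ × ℂ → ℝ, (∀ w b, 0 < ε w b) ∧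
      ∀ (ctr : ↥D → ℂ × ℂ × ℂ) (F : ↥D → ℂ × ℂ × ℂ → ℝ),
      (∀ v, ctr v ∈ Set.range fun t : Fin 3 → ℝ => esymm3 fun i => Complex.exp ((t i : ℂ) * I)) → (∀ v, ContDiff ℝ ∞ (F v)) →
      (∀ v, tsupport (F v) ⊆ ball (ctr v) (ε v (ctr v))) →
      ∀ a' : ↥(arch (↥(maximalRealSubfield L)) L (IsCMField.complexConj L) 3 (Matrix.diagonal α)) → ℂ, ArchSmooth L 3 (Matrix.diagonal α) a' →
        ∃ f : ↥(arch (↥(maximalRealSubfield L)) L (IsCMField.complexConj L) 3 (Matrix.diagonal β)) → ℂ, ArchSmooth L 3 (Matrix.diagonal β) f ∧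
          ∀ (S : Finset {w : InfinitePlace L // IsComplex w}) (c : {w : InfinitePlace L // IsComplex w} → Fin 3 → ℝ), c ∈ RegG S →
            stableSumG (orbFamGExt L β μ f) S c =
              κ * stableSumG (orbFamGExt L α μ' (fun k => ((∏ v, F v (bzClassG L α k v) : ℝ) : ℂ) * a' k)) S c := by
  obtain ⟨ε, hε, hB⟩ := hBall
  exact ⟨ε, hε, ballTransferBody_of_isHaarMeasure L α β ν₀' ν₀ μ' μ D ε κ hB⟩

end Shapes

/-! ## §3 The product-convention pair as the reference -/

section ProdConvention

variable (L : Type) [Field L] [NumberField L] [IsCMField L] (α β : Fin 3 → L)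
  [∀ w : {w : InfinitePlace L // IsComplex w}, MeasurableSpace ↥(archLocal L 3 (Matrix.diagonal α) w)]
  [∀ w : {w : InfinitePlace L // IsComplex w}, BorelSpace ↥(archLocal L 3 (Matrix.diagonal α) w)]
  [∀ w : {w : InfinitePlace L // IsComplex w}, MeasurableSpace ↥(archLocal L 3 (Matrix.diagonal β) w)]
  [∀ w : {w : InfinitePlace L // IsComplex w}, BorelSpace ↥(archLocal L 3 (Matrix.diagonal β) w)]
  [MeasurableSpace ↥(arch (↥(maximalRealSubfield L)) L (IsCMField.complexConj L) 3 (Matrix.diagonal α))] [BorelSpace ↥(arch (↥(maximalRealSubfield L)) L (IsCMField.complexConj L) 3 (Matrix.diagonal α))]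
  [MeasurableSpace ↥(arch (↥(maximalRealSubfield L)) L (IsCMField.complexConj L) 3 (Matrix.diagonal β))] [BorelSpace ↥(arch (↥(maximalRealSubfield L)) L (IsCMField.complexConj L) 3 (Matrix.diagonal β))]
  (ν'w : ∀ w : {w : InfinitePlace L // IsComplex w}, Measure ↥(archLocal L 3 (Matrix.diagonal α) w)) [∀ w, (ν'w w).IsHaarMeasure] [∀ w, (ν'w w).IsMulRightInvariant]
  (νβw : ∀ w : {w : InfinitePlace L // IsComplex w}, Measure ↥(archLocal L 3 (Matrix.diagonal β) w)) [∀ w, (νβw w).IsHaarMeasure] [∀ w, (νβw w).IsMulRightInvariant]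
  (μ' : Measure ↥(arch (↥(maximalRealSubfield L)) L (IsCMField.complexConj L) 3 (Matrix.diagonal α))) [μ'.IsHaarMeasure] [μ'.IsMulRightInvariant]
  (μ : Measure ↥(arch (↥(maximalRealSubfield L)) L (IsCMField.complexConj L) 3 (Matrix.diagonal β))) [μ.IsHaarMeasure] [μ.IsMulRightInvariant]

/-- **THE TRANSFER SENTENCE AT ARBITRARY HAAR `(μ′, μ)` FROM THE PRODUCT-CONVENTION PAIR** `(e⁻¹_* ⊗_w ν′_w, e⁻¹_* ⊗_w νβ_w)` (★ `isHaarMeasure_prodConventionG`,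
★ `isMulRightInvariant_prodConventionG`), for any Haar families `ν′w`, `νβw` on the place components. [cite: Folland1995, §2.2 Thm. 2.20] [cite: BorelJacquet1979, §4.1]
[cite: Rogawski1990, §1.7 p. 6; §4.1 (4.1.1) p. 39] -/
theorem exists_archSmooth_stableSumG_eq_const_mul_of_prodConvention (κ : ℂ) (g : ↥(arch (↥(maximalRealSubfield L)) L (IsCMField.complexConj L) 3 (Matrix.diagonal α)) → ℂ)
    (h : haveI := isHaarMeasure_prodConventionG L α ν'w
      haveI := isMulRightInvariant_prodConventionG L α ν'w
      haveI := isHaarMeasure_prodConventionG L β νβw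
      haveI := isMulRightInvariant_prodConventionG L β νβw
      ∃ f : ↥(arch (↥(maximalRealSubfield L)) L (IsCMField.complexConj L) 3 (Matrix.diagonal β)) → ℂ, ArchSmooth L 3 (Matrix.diagonal β) f ∧
      ∀ (S : Finset {w : InfinitePlace L // IsComplex w}) (c : {w : InfinitePlace L // IsComplex w} → Fin 3 → ℝ), c ∈ RegG S →
        stableSumG (orbFamGExt L β ((Measure.pi νβw).map (archPiEquivCM 3 L (Matrix.diagonal β)).symm) f) S c =
          κ * stableSumG (orbFamGExt L α ((Measure.pi ν'w).map (archPiEquivCM 3 L (Matrix.diagonal α)).symm) g) S c) :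
    ∃ f : ↥(arch (↥(maximalRealSubfield L)) L (IsCMField.complexConj L) 3 (Matrix.diagonal β)) → ℂ, ArchSmooth L 3 (Matrix.diagonal β) f ∧
      ∀ (S : Finset {w : InfinitePlace L // IsComplex w}) (c : {w : InfinitePlace L // IsComplex w} → Fin 3 → ℝ), c ∈ RegG S →
        stableSumG (orbFamGExt L β μ f) S c = κ * stableSumG (orbFamGExt L α μ' g) S c := by
  haveI := isHaarMeasure_prodConventionG L α ν'w
  haveI := isMulRightInvariant_prodConventionG L α ν'w
  haveI := isHaarMeasure_prodConventionG L β νβw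
  haveI := isMulRightInvariant_prodConventionG L β νβw
  exact exists_archSmooth_stableSumG_eq_const_mul_of_isHaarMeasure L α β κ g _ _ μ' μ h

/-- **THE (L2)-MEASURES HEAD AT THE PRODUCT-CONVENTION REFERENCE PAIR**: `ballTransfer_of_isHaarMeasure` with `(ν₀′, ν₀) := ((Measure.pi ν′w).map eα.symm, (Measure.pi νβw).map eβ.symm)`
for ANY Haar families `ν′w`, `νβw` on the place components (instances ★ `isHaarMeasure_prodConventionG` ∕ ★ `isMulRightInvariant_prodConventionG` supplied here) — (L2) proves the
ball transfers in the product currency of ★ (F2) ∕ ★ E2b ∕ ★ (IT)-3 and reads them at the head's free `(μ′, μ)`. [cite: Folland1995, §2.2 Thm. 2.20] [cite: BorelJacquet1979, §4.1]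
[cite: Rogawski1990, §1.7 p. 6; §14.2 (14.2.1) p. 232] -/
theorem ballTransfer_of_prodConvention {X : Type*} (P : X → Prop) (A : X → ↥(arch (↥(maximalRealSubfield L)) L (IsCMField.complexConj L) 3 (Matrix.diagonal α)) → ℂ) (κ : ℂ)
    (h : haveI := isHaarMeasure_prodConventionG L α ν'w
      haveI := isMulRightInvariant_prodConventionG L α ν'w
      haveI := isHaarMeasure_prodConventionG L β νβw
      haveI := isMulRightInvariant_prodConventionG L β νβw
      ∀ x, P x → ∃ f : ↥(arch (↥(maximalRealSubfield L)) L (IsCMField.complexConj L) 3 (Matrix.diagonal β)) → ℂ, ArchSmooth L 3 (Matrix.diagonal β) f ∧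
      ∀ (S : Finset {w : InfinitePlace L // IsComplex w}) (c : {w : InfinitePlace L // IsComplex w} → Fin 3 → ℝ), c ∈ RegG S →
        stableSumG (orbFamGExt L β ((Measure.pi νβw).map (archPiEquivCM 3 L (Matrix.diagonal β)).symm) f) S c =
          κ * stableSumG (orbFamGExt L α ((Measure.pi ν'w).map (archPiEquivCM 3 L (Matrix.diagonal α)).symm) (A x)) S c) :
    ∀ x, P x → ∃ f : ↥(arch (↥(maximalRealSubfield L)) L (IsCMField.complexConj L) 3 (Matrix.diagonal β)) → ℂ, ArchSmooth L 3 (Matrix.diagonal β) f ∧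
      ∀ (S : Finset {w : InfinitePlace L // IsComplex w}) (c : {w : InfinitePlace L // IsComplex w} → Fin 3 → ℝ), c ∈ RegG S →
        stableSumG (orbFamGExt L β μ f) S c = κ * stableSumG (orbFamGExt L α μ' (A x)) S c := by
  haveI := isHaarMeasure_prodConventionG L α ν'w
  haveI := isMulRightInvariant_prodConventionG L α ν'w
  haveI := isHaarMeasure_prodConventionG L β νβw
  haveI := isMulRightInvariant_prodConventionG L β νβw
  exact ballTransfer_of_isHaarMeasure L α β P A κ _ _ μ' μ h

/-- **E3-SUM ED. 2's `hBall` BODY AT ARBITRARY HAAR `(μ′, μ)` FROM THE PRODUCT-CONVENTION PAIR** — the docking letter of (L2) `ballTransfer_fixed`: prove the per-ball transfers with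
`ν′ := e⁻¹_* ⊗_w ν′_w`, `νβ := e⁻¹_* ⊗_w νβ_w` (any Haar families; (L2) takes `νβ_w := (ι_w)_* ν′_w` on the `α`-indefinite block) and read them at the head's free `(μ′, μ)`.
[cite: Rogawski1990, §14.2 (14.2.1) p. 232; §1.7 p. 6] [cite: Folland1995, §2.2 Thm. 2.20] [cite: Shelstad1979, §4 p. 24] -/
theorem ballTransferFixedBody_of_prodConvention (D : Finset {w : InfinitePlace L // IsComplex w})
    (a' : ↥(arch (↥(maximalRealSubfield L)) L (IsCMField.complexConj L) 3 (Matrix.diagonal α)) → ℂ)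
    (ε : {w : InfinitePlace L // IsComplex w} → ℂ × ℂ × ℂ → ℝ) (κ : ℂ)
    (hBall : haveI := isHaarMeasure_prodConventionG L α ν'w
      haveI := isMulRightInvariant_prodConventionG L α ν'w
      haveI := isHaarMeasure_prodConventionG L β νβw
      haveI := isMulRightInvariant_prodConventionG L β νβw
      ∀ (ctr : ↥D → ℂ × ℂ × ℂ) (F : ↥D → ℂ × ℂ × ℂ → ℝ),
      (∀ v, ctr v ∈ Set.range fun t : Fin 3 → ℝ => esymm3 fun i => Complex.exp ((t i : ℂ) * I)) → (∀ v, ContDiff ℝ ∞ (F v)) →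
      (∀ v, tsupport (F v) ⊆ ball (ctr v) (ε v (ctr v))) →
        ∃ f : ↥(arch (↥(maximalRealSubfield L)) L (IsCMField.complexConj L) 3 (Matrix.diagonal β)) → ℂ, ArchSmooth L 3 (Matrix.diagonal β) f ∧
          ∀ (S : Finset {w : InfinitePlace L // IsComplex w}) (c : {w : InfinitePlace L // IsComplex w} → Fin 3 → ℝ), c ∈ RegG S →
            stableSumG (orbFamGExt L β ((Measure.pi νβw).map (archPiEquivCM 3 L (Matrix.diagonal β)).symm) f) S c =
              κ * stableSumG (orbFamGExt L α ((Measure.pi ν'w).map (archPiEquivCM 3 L (Matrix.diagonal α)).symm)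
                (fun k => ((∏ v, F v (bzClassG L α k v) : ℝ) : ℂ) * a' k)) S c) :
    ∀ (ctr : ↥D → ℂ × ℂ × ℂ) (F : ↥D → ℂ × ℂ × ℂ → ℝ),
      (∀ v, ctr v ∈ Set.range fun t : Fin 3 → ℝ => esymm3 fun i => Complex.exp ((t i : ℂ) * I)) → (∀ v, ContDiff ℝ ∞ (F v)) →
      (∀ v, tsupport (F v) ⊆ ball (ctr v) (ε v (ctr v))) →
        ∃ f : ↥(arch (↥(maximalRealSubfield L)) L (IsCMField.complexConj L) 3 (Matrix.diagonal β)) → ℂ, ArchSmooth L 3 (Matrix.diagonal β) f ∧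
          ∀ (S : Finset {w : InfinitePlace L // IsComplex w}) (c : {w : InfinitePlace L // IsComplex w} → Fin 3 → ℝ), c ∈ RegG S →
            stableSumG (orbFamGExt L β μ f) S c =
              κ * stableSumG (orbFamGExt L α μ' (fun k => ((∏ v, F v (bzClassG L α k v) : ℝ) : ℂ) * a' k)) S c := by
  haveI := isHaarMeasure_prodConventionG L α ν'w
  haveI := isMulRightInvariant_prodConventionG L α ν'w
  haveI := isHaarMeasure_prodConventionG L β νβw
  haveI := isMulRightInvariant_prodConventionG L β νβw
  exact ballTransferFixedBody_of_isHaarMeasure L α β _ _ μ' μ D a' ε κ hBall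

/-- **E3-SUM ED. 1's `hBall` BODY (`∀ a′` inside) AT ARBITRARY HAAR `(μ′, μ)` FROM THE PRODUCT-CONVENTION PAIR.** [cite: Rogawski1990, §14.2 (14.2.1) p. 232; §1.7 p. 6]
[cite: Folland1995, §2.2 Thm. 2.20] [cite: Shelstad1979, §4 p. 24] -/
theorem ballTransferBody_of_prodConvention (D : Finset {w : InfinitePlace L // IsComplex w})
    (ε : {w : InfinitePlace L // IsComplex w} → ℂ × ℂ × ℂ → ℝ) (κ : ℂ)
    (hBall : haveI := isHaarMeasure_prodConventionG L α ν'w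
      haveI := isMulRightInvariant_prodConventionG L α ν'w
      haveI := isHaarMeasure_prodConventionG L β νβw
      haveI := isMulRightInvariant_prodConventionG L β νβw
      ∀ (ctr : ↥D → ℂ × ℂ × ℂ) (F : ↥D → ℂ × ℂ × ℂ → ℝ),
      (∀ v, ctr v ∈ Set.range fun t : Fin 3 → ℝ => esymm3 fun i => Complex.exp ((t i : ℂ) * I)) → (∀ v, ContDiff ℝ ∞ (F v)) →
      (∀ v, tsupport (F v) ⊆ ball (ctr v) (ε v (ctr v))) →
      ∀ a' : ↥(arch (↥(maximalRealSubfield L)) L (IsCMField.complexConj L) 3 (Matrix.diagonal α)) → ℂ, ArchSmooth L 3 (Matrix.diagonal α) a' →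
        ∃ f : ↥(arch (↥(maximalRealSubfield L)) L (IsCMField.complexConj L) 3 (Matrix.diagonal β)) → ℂ, ArchSmooth L 3 (Matrix.diagonal β) f ∧
          ∀ (S : Finset {w : InfinitePlace L // IsComplex w}) (c : {w : InfinitePlace L // IsComplex w} → Fin 3 → ℝ), c ∈ RegG S →
            stableSumG (orbFamGExt L β ((Measure.pi νβw).map (archPiEquivCM 3 L (Matrix.diagonal β)).symm) f) S c =
              κ * stableSumG (orbFamGExt L α ((Measure.pi ν'w).map (archPiEquivCM 3 L (Matrix.diagonal α)).symm)
                (fun k => ((∏ v, F v (bzClassG L α k v) : ℝ) : ℂ) * a' k)) S c) :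
    ∀ (ctr : ↥D → ℂ × ℂ × ℂ) (F : ↥D → ℂ × ℂ × ℂ → ℝ),
      (∀ v, ctr v ∈ Set.range fun t : Fin 3 → ℝ => esymm3 fun i => Complex.exp ((t i : ℂ) * I)) → (∀ v, ContDiff ℝ ∞ (F v)) →
      (∀ v, tsupport (F v) ⊆ ball (ctr v) (ε v (ctr v))) →
      ∀ a' : ↥(arch (↥(maximalRealSubfield L)) L (IsCMField.complexConj L) 3 (Matrix.diagonal α)) → ℂ, ArchSmooth L 3 (Matrix.diagonal α) a' →
        ∃ f : ↥(arch (↥(maximalRealSubfield L)) L (IsCMField.complexConj L) 3 (Matrix.diagonal β)) → ℂ, ArchSmooth L 3 (Matrix.diagonal β) f ∧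
          ∀ (S : Finset {w : InfinitePlace L // IsComplex w}) (c : {w : InfinitePlace L // IsComplex w} → Fin 3 → ℝ), c ∈ RegG S →
            stableSumG (orbFamGExt L β μ f) S c =
              κ * stableSumG (orbFamGExt L α μ' (fun k => ((∏ v, F v (bzClassG L α k v) : ℝ) : ℂ) * a' k)) S c := by
  haveI := isHaarMeasure_prodConventionG L α ν'w
  haveI := isMulRightInvariant_prodConventionG L α ν'w
  haveI := isHaarMeasure_prodConventionG L β νβw
  haveI := isMulRightInvariant_prodConventionG L β νβw
  exact ballTransferBody_of_isHaarMeasure L α β _ _ μ' μ D ε κ hBall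

/-- **THE (L2) HEAD SHAPE `∃ ε, (∀ w b, 0 < ε w b) ∧ ⟨ED. 2 body⟩` AT ARBITRARY HAAR `(μ′, μ)` FROM THE PRODUCT-CONVENTION PAIR.** [cite: Rogawski1990, §14.2 (14.2.1) p. 232; §1.7 p. 6]
[cite: Folland1995, §2.2 Thm. 2.20] -/
theorem exists_radius_ballTransferFixedBody_of_prodConvention (D : Finset {w : InfinitePlace L // IsComplex w})
    (a' : ↥(arch (↥(maximalRealSubfield L)) L (IsCMField.complexConj L) 3 (Matrix.diagonal α)) → ℂ) (κ : ℂ)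
    (hBall : haveI := isHaarMeasure_prodConventionG L α ν'w
      haveI := isMulRightInvariant_prodConventionG L α ν'w
      haveI := isHaarMeasure_prodConventionG L β νβw
      haveI := isMulRightInvariant_prodConventionG L β νβw
      ∃ ε : {w : InfinitePlace L // IsComplex w} → ℂ × ℂ × ℂ → ℝ, (∀ w b, 0 < ε w b) ∧
      ∀ (ctr : ↥D → ℂ × ℂ × ℂ) (F : ↥D → ℂ × ℂ × ℂ → ℝ),
      (∀ v, ctr v ∈ Set.range fun t : Fin 3 → ℝ => esymm3 fun i => Complex.exp ((t i : ℂ) * I)) → (∀ v, ContDiff ℝ ∞ (F v)) →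
      (∀ v, tsupport (F v) ⊆ ball (ctr v) (ε v (ctr v))) →
        ∃ f : ↥(arch (↥(maximalRealSubfield L)) L (IsCMField.complexConj L) 3 (Matrix.diagonal β)) → ℂ, ArchSmooth L 3 (Matrix.diagonal β) f ∧
          ∀ (S : Finset {w : InfinitePlace L // IsComplex w}) (c : {w : InfinitePlace L // IsComplex w} → Fin 3 → ℝ), c ∈ RegG S →
            stableSumG (orbFamGExt L β ((Measure.pi νβw).map (archPiEquivCM 3 L (Matrix.diagonal β)).symm) f) S c =
              κ * stableSumG (orbFamGExt L α ((Measure.pi ν'w).map (archPiEquivCM 3 L (Matrix.diagonal α)).symm)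
                (fun k => ((∏ v, F v (bzClassG L α k v) : ℝ) : ℂ) * a' k)) S c) :
    ∃ ε : {w : InfinitePlace L // IsComplex w} → ℂ × ℂ × ℂ → ℝ, (∀ w b, 0 < ε w b) ∧
      ∀ (ctr : ↥D → ℂ × ℂ × ℂ) (F : ↥D → ℂ × ℂ × ℂ → ℝ),
      (∀ v, ctr v ∈ Set.range fun t : Fin 3 → ℝ => esymm3 fun i => Complex.exp ((t i : ℂ) * I)) → (∀ v, ContDiff ℝ ∞ (F v)) →
      (∀ v, tsupport (F v) ⊆ ball (ctr v) (ε v (ctr v))) →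
        ∃ f : ↥(arch (↥(maximalRealSubfield L)) L (IsCMField.complexConj L) 3 (Matrix.diagonal β)) → ℂ, ArchSmooth L 3 (Matrix.diagonal β) f ∧
          ∀ (S : Finset {w : InfinitePlace L // IsComplex w}) (c : {w : InfinitePlace L // IsComplex w} → Fin 3 → ℝ), c ∈ RegG S →
            stableSumG (orbFamGExt L β μ f) S c =
              κ * stableSumG (orbFamGExt L α μ' (fun k => ((∏ v, F v (bzClassG L α k v) : ℝ) : ℂ) * a' k)) S c := by
  haveI := isHaarMeasure_prodConventionG L α ν'w
  haveI := isMulRightInvariant_prodConventionG L α ν'w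
  haveI := isHaarMeasure_prodConventionG L β νβw
  haveI := isMulRightInvariant_prodConventionG L β νβw
  exact exists_radius_ballTransferFixedBody_of_isHaarMeasure L α β _ _ μ' μ D a' κ hBall

/-- **THE (L3) HEAD'S `hBall` SHAPE `∃ ε, (∀ w b, 0 < ε w b) ∧ ⟨ED. 1 body⟩` AT ARBITRARY HAAR `(μ′, μ)` FROM THE PRODUCT-CONVENTION PAIR.** [cite: Rogawski1990, §14.2 (14.2.1) p. 232; §1.7 p. 6]
[cite: Folland1995, §2.2 Thm. 2.20] -/
theorem exists_radius_ballTransferBody_of_prodConvention (D : Finset {w : InfinitePlace L // IsComplex w}) (κ : ℂ)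
    (hBall : haveI := isHaarMeasure_prodConventionG L α ν'w
      haveI := isMulRightInvariant_prodConventionG L α ν'w
      haveI := isHaarMeasure_prodConventionG L β νβw
      haveI := isMulRightInvariant_prodConventionG L β νβw
      ∃ ε : {w : InfinitePlace L // IsComplex w} → ℂ × ℂ × ℂ → ℝ, (∀ w b, 0 < ε w b) ∧
      ∀ (ctr : ↥D → ℂ × ℂ × ℂ) (F : ↥D → ℂ × ℂ × ℂ → ℝ),
      (∀ v, ctr v ∈ Set.range fun t : Fin 3 → ℝ => esymm3 fun i => Complex.exp ((t i : ℂ) * I)) → (∀ v, ContDiff ℝ ∞ (F v)) →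
      (∀ v, tsupport (F v) ⊆ ball (ctr v) (ε v (ctr v))) →
      ∀ a' : ↥(arch (↥(maximalRealSubfield L)) L (IsCMField.complexConj L) 3 (Matrix.diagonal α)) → ℂ, ArchSmooth L 3 (Matrix.diagonal α) a' →
        ∃ f : ↥(arch (↥(maximalRealSubfield L)) L (IsCMField.complexConj L) 3 (Matrix.diagonal β)) → ℂ, ArchSmooth L 3 (Matrix.diagonal β) f ∧
          ∀ (S : Finset {w : InfinitePlace L // IsComplex w}) (c : {w : InfinitePlace L // IsComplex w} → Fin 3 → ℝ), c ∈ RegG S →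
            stableSumG (orbFamGExt L β ((Measure.pi νβw).map (archPiEquivCM 3 L (Matrix.diagonal β)).symm) f) S c =
              κ * stableSumG (orbFamGExt L α ((Measure.pi ν'w).map (archPiEquivCM 3 L (Matrix.diagonal α)).symm)
                (fun k => ((∏ v, F v (bzClassG L α k v) : ℝ) : ℂ) * a' k)) S c) :
    ∃ ε : {w : InfinitePlace L // IsComplex w} → ℂ × ℂ × ℂ → ℝ, (∀ w b, 0 < ε w b) ∧
      ∀ (ctr : ↥D → ℂ × ℂ × ℂ) (F : ↥D → ℂ × ℂ × ℂ → ℝ),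
      (∀ v, ctr v ∈ Set.range fun t : Fin 3 → ℝ => esymm3 fun i => Complex.exp ((t i : ℂ) * I)) → (∀ v, ContDiff ℝ ∞ (F v)) →
      (∀ v, tsupport (F v) ⊆ ball (ctr v) (ε v (ctr v))) →
      ∀ a' : ↥(arch (↥(maximalRealSubfield L)) L (IsCMField.complexConj L) 3 (Matrix.diagonal α)) → ℂ, ArchSmooth L 3 (Matrix.diagonal α) a' →
        ∃ f : ↥(arch (↥(maximalRealSubfield L)) L (IsCMField.complexConj L) 3 (Matrix.diagonal β)) → ℂ, ArchSmooth L 3 (Matrix.diagonal β) f ∧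
          ∀ (S : Finset {w : InfinitePlace L // IsComplex w}) (c : {w : InfinitePlace L // IsComplex w} → Fin 3 → ℝ), c ∈ RegG S →
            stableSumG (orbFamGExt L β μ f) S c =
              κ * stableSumG (orbFamGExt L α μ' (fun k => ((∏ v, F v (bzClassG L α k v) : ℝ) : ℂ) * a' k)) S c := by
  haveI := isHaarMeasure_prodConventionG L α ν'w
  haveI := isMulRightInvariant_prodConventionG L α ν'w
  haveI := isHaarMeasure_prodConventionG L β νβw
  haveI := isMulRightInvariant_prodConventionG L β νβw
  exact exists_radius_ballTransferBody_of_isHaarMeasure L α β _ _ μ' μ D κ hBall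

end ProdConvention

end Literature.NumberTheory.Rogawski1990

end
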